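import Summits.QuantumFields.QCD.Theorems.WilsonMobilityGapChiralMobilityGapAnchorDefs
import HarnessLib.Audit.Tags

/-!
# Crux `ChiralMobilityGap` (stmt-QuantumFields-17497) — the four OPEN PHYSICAL NODES of line `Ideator3Sketch`
# (card `sign-threshold-anchor`), named as `@[conjecture]` targets

The registered skeleton `Cruxes/ChiralMobilityGap/Lines/Ideator3Sketch.lean` (v8, sha f8fa2683; leads c0–c4 of the
crux, five concurring lead cycles, four stub-worker waves) is kernel-closed modulo FOUR registered stubs about ONE explicit
object, the sign-anchored regularisation `anchorReg N_f` of `…ChiralMobilityGapAnchorDefs.lean` (p137198): a pion-correlator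
CEILING at a physical rate, a first-moment FLOOR at a finite physical rate, a first-moment floor at an ARBITRARILY SMALL
physical rate (chirality of the anchor), and the two fractional-moment clauses at SPLIT mass tuples.  Everything else the
crux asks of the witness is LANDED (scalings, clause (i), clause (iv), the `N_f = 3` pion-weight sign input, super-log
volumes, the pin lemmas, the transfer `chiralMobilityGap_of_anchorCore` p138003, glue A p140335, glue B′ p140812, the
sandwich tightness record p142602).

This file gives the four stubs NAMES importable from `Theorems/` (the `Cruxes/` workfile is not importable), verbatim the
registered signatures, so that (i) the composition can be landed as a conditional closer BY NAME
(`…ChiralMobilityGapOfAnchorCore.lean`: `AnchorPionCeiling → AnchorFloorFinite → AnchorFloorChiral → AnchorSplit →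
ChiralMobilityGap`), (ii) each node is separately provable / refutable / groundable by name (they are logically
independent physical claims; the sandwich record p142602 already turns a `t`-uniform pion-ceiling rate into a refutation
of `AnchorFloorChiral`), and (iii) the skeleton's stubs can be registered as `<node>`-typed goals.
NOTHING IS CLAIMED HERE: all four are UNPROVED statements of constructive lattice QCD along an asymptotically free
Wilson trajectory at light quark masses — hadron-mass bounds in physical units, uniform in the volume, eventually in
the cutoff.  No published source proves any of them, in any regularisation: every rigorous quark-line / clustering
result for lattice QCD lives in the absolutely convergent hopping / strong-coupling domain (`κ ≪ 1/8`, `β` small), where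
the gap is a LATTICE gap (barriers `Literature/Barriers/QuantumFields/HoppingExpansionUniformGap`,
`…/PerturbativeInvisibility`; location of the anchor: `…/AokiPhase`, `…/WilsonDeterminantSign`).  See
`Cruxes/ChiralMobilityGap/LEAD-c1.md … LEAD-c4.md`, `HANDOFF.md` for the analysis and the worker goal dumps.

Currency (all from `MobilityGap/Negative/LowerPin.lean`): `fm N_f β b S f v s = E₊[(Σ_{a,i,b,j}|G_f(U)((0,a,i),(v,b,j))|)^s]`,
the `|∏_g det D_W(b_g)|`-weighted (phase-quenched) `s`-th moment of the colour–spin entry sum of the flavour-`f` Wilson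
quark propagator block from `0` to `v` on the torus of side `2S+1` at inverse coupling `β` and bare tuple `b`;
`bare reg m k = (m_crit(k) + a_k m_f / Z_m(k))_f`; `Upper` / `Lower` = clauses (ii) / (iii) of the crux verbatim.
-/

noncomputable section

namespace Summit.QuantumFields.QCD.Theorems.ChiralMobilityGapAnchor

open scoped BigOperators Topology
open MeasureTheory Filter Set
open Literature.MathematicalPhysics.QuantumFieldTheory Literature.MathematicalPhysics.QuantumLattice
  Literature.Probability.LatticeModels
open Summit.QuantumFields.QCD.Theorems.MobilityGapNegative (bare fm Upper Lower)

/-- **AnchorPionCeiling** — node 1 of line `Ideator3Sketch` of crux `ChiralMobilityGap` (UNPROVED, named here as a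
target; verbatim the registered stub `stub_pionCeiling` of skeleton v8).  For `N_f ∈ {2,3}` and every renormalised mass
`t > 0` there are `δ > 0` and `C` such that, eventually in `k`, on EVERY torus of half-side `S ≥ L_k`, for every flavour
and every `v ∈ {-S..S}⁴`, the phase-quenched SECOND moment of the entry sum along the anchored degenerate trajectory
`b_k = anchorThr + a_k t / Z_m(k)` obeys `fm(…, v, 2) ≤ C e^{-δ a_k ‖v‖∞}`.  Since `E₊‖G_f(0,v)‖²_F ≤ fm(2) ≤ 144 E₊‖G_f(0,v)‖²_F`
and `‖G_f(0,v)‖²_F` is configuration-wise the charged-pion two-point function of two degenerate flavours, this says: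
"the pion of the anchored lattice theory is MASSIVE at positive renormalised quark mass, with a mass bounded below in
PHYSICAL units uniformly in the volume and the cutoff" — a hadron-mass lower bound along an asymptotically free Wilson
trajectory.  Feeds clause (ii) on the diagonal (glue A, p140335) and the ceiling half of clause (iii) (glue B′, p140812).
STATUS: OPEN — posed in this programme (crux stmt-QuantumFields-17497, `Cruxes/ChiralMobilityGap/LEAD-c3.md`, `LEAD-c4.md`
§2); no published source states or proves it.  Nearest published results: exponential clustering of lattice QCD
correlations by convergent cluster expansion at strong coupling and heavy hopping parameter only (the analogue in the
wrong regime, not this statement); numerically the statement is lattice folklore (GMOR scaling of `m_π²` in the quark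
mass outside the Aoki phase).
[cite: OsterwalderSeiler1978, §§3–4 (cluster expansion and exponential clustering for β small, κ small): the analogue, not this statement]
[cite: MontvayMunster1994, §5.1 (Wilson quark masses, critical hopping parameter, pion mass): the physics, not a theorem]
[cite: SharpeSingleton1998, §III (chiral Lagrangian for Wilson fermions: m_π² vs quark mass, Aoki / first-order scenarios): the physics, not a theorem]
[status: open] -/
@[conjecture] def AnchorPionCeiling : Prop :=
  ∀ Nf : ℕ, Nf = 2 ∨ Nf = 3 → ∀ t : ℝ, 0 < t →
    ∃ δ C : ℝ, 0 < δ ∧ ∀ᶠ k in atTop, ∀ S : ℕ, (anchorReg Nf).L k ≤ S →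
      ∀ (f : Fin Nf) (v : Site 4), v ∈ box 4 S →
        fm Nf ((anchorReg Nf).β k) (bare (anchorReg Nf) (fun _ => t) k) S f v 2 ≤
          C * Real.exp (-(δ * ((anchorReg Nf).a k * ‖v‖)))

/-- Unfolding lemma: `AnchorPionCeiling` IS, definitionally, the registered stub signature `stub_pionCeiling` (v8). -/
theorem anchorPionCeiling_iff : AnchorPionCeiling ↔
    ∀ Nf : ℕ, Nf = 2 ∨ Nf = 3 → ∀ t : ℝ, 0 < t →
      ∃ δ C : ℝ, 0 < δ ∧ ∀ᶠ k in atTop, ∀ S : ℕ, (anchorReg Nf).L k ≤ S →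
        ∀ (f : Fin Nf) (v : Site 4), v ∈ box 4 S →
          fm Nf ((anchorReg Nf).β k) (bare (anchorReg Nf) (fun _ => t) k) S f v 2 ≤
            C * Real.exp (-(δ * ((anchorReg Nf).a k * ‖v‖))) :=
  Iff.rfl

/-- **AnchorFloorFinite** — node 2a of line `Ideator3Sketch` of crux `ChiralMobilityGap` (UNPROVED, named here as a
target; verbatim the registered stub `stub_floorFinite` of skeleton v8).  For `N_f ∈ {2,3}` and every renormalised mass
`t > 0` there are `μ`, `c > 0`, `q` such that, eventually in `k`, on every torus `S ≥ L_k`, for every flavour and every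
`n ≤ S`, the phase-quenched FIRST moment of the entry sum at time-axis separation `n` along the anchored degenerate
trajectory obeys `c e^{-(μ a_k n + q log(n+1))} ≤ fm(…, n e₀, 1)`: "quarks of renormalised mass `t` are not
lattice-heavy at the anchor" — an UPPER bound `μ(t) < ∞` on a hadronic decay rate in PHYSICAL units (the anchor
`anchorThr(k)` does not undershoot the chiral critical line `m_c(β_k)` by more than `O(a_k/Z_m)`), with at most
power-law short-distance suppression and no anomalous suppression of the first moment against the second.  Feeds
clause (iii) on the diagonal through glue B′ (p140812) together with node 1.  Known partial information: the row
identity `(G·D)(0,0) = 1` gives only a floor on the MAXIMUM of `fm(·,1)` over the 9-site shell `{0, ±e_μ}`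
(LEAD-c4 §2), i.e. nothing at separations `n ≥ 2`.
STATUS: OPEN — posed in this programme (crux stmt-QuantumFields-17497, `LEAD-c3.md`, `LEAD-c4.md` §2–§3); no published
source states or proves it; the rigorous literature has RELATIVE ceilings between hadron correlators (Weingarten
mass inequalities), never an absolute floor at a physical rate.
[cite: Weingarten1983, (mass inequalities from positivity of the fermion measure): a relative ceiling, not this floor]
[cite: SharpeSingleton1998, §III (GMOR outside the Aoki phase; identification of the critical line): the physics, not a theorem]
[status: open] -/
@[conjecture] def AnchorFloorFinite : Prop :=
  ∀ Nf : ℕ, Nf = 2 ∨ Nf = 3 → ∀ t : ℝ, 0 < t →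
    ∃ μ c q : ℝ, 0 < c ∧ ∀ᶠ k in atTop, ∀ S : ℕ, (anchorReg Nf).L k ≤ S →
      ∀ (f : Fin Nf) (n : ℕ), n ≤ S →
        c * Real.exp (-(μ * ((anchorReg Nf).a k * n) + q * Real.log (n + 1))) ≤
          fm Nf ((anchorReg Nf).β k) (bare (anchorReg Nf) (fun _ => t) k) S f (Pi.single 0 (n : ℤ)) 1

/-- Unfolding lemma: `AnchorFloorFinite` IS, definitionally, the registered stub signature `stub_floorFinite` (v8). -/
theorem anchorFloorFinite_iff : AnchorFloorFinite ↔
    ∀ Nf : ℕ, Nf = 2 ∨ Nf = 3 → ∀ t : ℝ, 0 < t →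
      ∃ μ c q : ℝ, 0 < c ∧ ∀ᶠ k in atTop, ∀ S : ℕ, (anchorReg Nf).L k ≤ S →
        ∀ (f : Fin Nf) (n : ℕ), n ≤ S →
          c * Real.exp (-(μ * ((anchorReg Nf).a k * n) + q * Real.log (n + 1))) ≤
            fm Nf ((anchorReg Nf).β k) (bare (anchorReg Nf) (fun _ => t) k) S f (Pi.single 0 (n : ℤ)) 1 :=
  Iff.rfl

/-- **AnchorFloorChiral** — node 2b of line `Ideator3Sketch` of crux `ChiralMobilityGap` (UNPROVED, named here as a
target; verbatim the registered stub `stub_floorChiral` of skeleton v8).  For `N_f ∈ {2,3}` and every `ε > 0` SOME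
renormalised mass `t > 0` carries a first-moment floor at physical rate `ε`: `c e^{-(ε a_k n + q log(n+1))} ≤ fm(…, n e₀, 1)`
on every torus `S ≥ L_k`, `n ≤ S`, eventually in `k` — "the sign anchor IS the chiral critical line to `o(a_k/Z_m)`":
the generalised sign threshold `anchorThr N_f β_k L_k` (infimum of the good floors of `GoodFloor`, AnchorDefs §1) sits
at `m_c(β_k) + a_k t*(k)/Z_m(k)` with `t*(k) → 0`, i.e. real modes of `D_W(U,0)` below `λ_c(β_k)` ("early crossers")
in the box of side `2L_k+1` are suppressed faster than the resolution `a_k/Z_m` of the mass trajectory (LEAD-c4 §3: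
two-sided squeeze; the late half needs only `χ_t > 0` and the super-log volumes, the early half is this node).
Through glue B′ and the sandwich record (p142602, `ceilingRate_le_two_mul_floorRate`) it forces the pion-ceiling rate
of node 1 to vanish along the chiral sequence, and it contains the kernel-necessary infrared core `LightMomentFree`
of the support crux (`lightMomentFree_of_anchorReg_vcr`, p138003).  It is the node whose physical SOUNDNESS is least
certain (it fails if early crossers are only power-suppressed at a rate slower than `a_k/Z_m`; numerical evidence —
spectral flow of the Wilson operator, negative-determinant fractions falling like a high power of `a` — supports it).
STATUS: OPEN — posed in this programme (crux stmt-QuantumFields-17497, `LEAD-c4.md` §3); no published source states or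
proves it.
[cite: EdwardsHellerNarayanan1998, §3–4 (spectral flow of the hermitian Wilson–Dirac operator; crossings occur on both sides of κ_c, the lowest crossing mass m₁ < m_c decreasing with β): numerical, the phenomenon behind this node]
[cite: MohlerSchaefer2020, §4 (fraction of negative real Wilson determinants at fixed physical volume falls steeply with the lattice spacing): numerical support, not a theorem]
[cite: SharpeSingleton1998, §III–IV (phase structure of Wilson fermions near κ_c): the physics of the anchor's location, not a theorem]
[status: open] -/
@[conjecture] def AnchorFloorChiral : Prop :=
  ∀ Nf : ℕ, Nf = 2 ∨ Nf = 3 → ∀ ε : ℝ, 0 < ε → ∃ t : ℝ, 0 < t ∧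
    ∃ c q : ℝ, 0 < c ∧ ∀ᶠ k in atTop, ∀ S : ℕ, (anchorReg Nf).L k ≤ S →
      ∀ (f : Fin Nf) (n : ℕ), n ≤ S →
        c * Real.exp (-(ε * ((anchorReg Nf).a k * n) + q * Real.log (n + 1))) ≤
          fm Nf ((anchorReg Nf).β k) (bare (anchorReg Nf) (fun _ => t) k) S f (Pi.single 0 (n : ℤ)) 1

/-- Unfolding lemma: `AnchorFloorChiral` IS, definitionally, the registered stub signature `stub_floorChiral` (v8). -/
theorem anchorFloorChiral_iff : AnchorFloorChiral ↔
    ∀ Nf : ℕ, Nf = 2 ∨ Nf = 3 → ∀ ε : ℝ, 0 < ε → ∃ t : ℝ, 0 < t ∧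
      ∃ c q : ℝ, 0 < c ∧ ∀ᶠ k in atTop, ∀ S : ℕ, (anchorReg Nf).L k ≤ S →
        ∀ (f : Fin Nf) (n : ℕ), n ≤ S →
          c * Real.exp (-(ε * ((anchorReg Nf).a k * n) + q * Real.log (n + 1))) ≤
            fm Nf ((anchorReg Nf).β k) (bare (anchorReg Nf) (fun _ => t) k) S f (Pi.single 0 (n : ℤ)) 1 :=
  Iff.rfl

/-- **AnchorSplit** — node 3 of line `Ideator3Sketch` of crux `ChiralMobilityGap` (UNPROVED, named here as a target;
verbatim the registered stub `stub_split` of skeleton v8).  Clauses (ii) UPPER and (iii) LOWER of the crux — in their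
own phase-quenched FRACTIONAL-moment form `Upper` / `Lower` of `MobilityGap/Negative/LowerPin.lean` — at every
NON-degenerate positive mass tuple along the anchored witness.  Off the diagonal the weight carries each
`|det D_W(b_f(k))|` only once, so second moments are not phase-quenched integrable and the (1,2)-moment currency of
nodes 1–2 is unavailable; no volume-uniform determinant-ratio / mass-reweighting inequality transfers the diagonal
clauses to split tuples (the ratio of partition functions is `e^{O(volume)}`, LEAD-c3/c4), so the split clauses are
their own physical claim (for `N_f = 2` this is also where clause (iv) has content, Disproof §2).
STATUS: OPEN — posed in this programme (crux stmt-QuantumFields-17497, `LEAD-c3.md`, `LEAD-c4.md` §2); no published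
source states or proves it (reweighting between quark masses is numerical practice, with determinant-ratio
fluctuations growing with the volume).
[cite: MontvayMunster1994, §7.3 (dynamical fermions: determinant ratios and their volume dependence): the obstruction to transfer, not this statement]
[cite: OsterwalderSeiler1978, §§3–4 (clustering at strong coupling / small κ for arbitrary mass tuples): the analogue in the wrong regime, not this statement]
[status: open] -/
@[conjecture] def AnchorSplit : Prop :=
  ∀ Nf : ℕ, Nf = 2 ∨ Nf = 3 → ∀ m : Fin Nf → ℝ, (∀ f, 0 < m f) →
    (∃ f g : Fin Nf, m f ≠ m g) → Upper (anchorReg Nf) m ∧ Lower (anchorReg Nf) m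

/-- Unfolding lemma: `AnchorSplit` IS, definitionally, the registered stub signature `stub_split` (v8). -/
theorem anchorSplit_iff : AnchorSplit ↔
    ∀ Nf : ℕ, Nf = 2 ∨ Nf = 3 → ∀ m : Fin Nf → ℝ, (∀ f, 0 < m f) →
      (∃ f g : Fin Nf, m f ≠ m g) → Upper (anchorReg Nf) m ∧ Lower (anchorReg Nf) m :=
  Iff.rfl

end Summit.QuantumFields.QCD.Theorems.ChiralMobilityGapAnchor

end
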